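import Literature.NumberTheory.LFunctions.YoshidaWindowGramEntryBox
import Mathlib.Analysis.SpecialFunctions.Trigonometric.Sinc
import HarnessLib

/-!
# rh-explicit (venture WeilGRH): CHRISTOFFEL CERTIFICATES — a kernel-decidable checker that turns one coefficient
  vector on a block of Yoshida's Gram matrix into a zero-free block for every Weil measure of the rung (weil-3 gen16)

Cell `rh-explicit`, WEIL TRACK (structure seat weil-3, gen16).  RH-free unless named; no new analysis — this file is
interval bookkeeping on top of `GramFormExclusion` (the theorem) and the tree's kernel enclosures of Yoshida's
matrix (`Literature…YoshidaWindowGramEntryBox`: `Encl.gramBox ∋ gramCoeff a n m` from a certified special-value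
table, as used by the format-C rungs `WeilFormatCData*`).

A CERTIFICATE is: a mode radius `N` (modes `n = i − N`, `i < 2N+1`), integer coefficients `c_i`, a block
`[p/q, p'/q]` and a piece count `K`.  The checker `Christoffel.checkCert` computes, at scale `S`,
* an enclosure `F` of the Gram form `Σ_{i,j} c_i c_j G_a(n_i, n_j)` from the table (`Christoffel.formBox`), and
* on each of the `K` pieces `T` of the block a lower bound `P_T` of the profile
  `‖(Σ_i c_i χ_{n_i})^(½+it)‖² = 2a·(Σ_i c_i sinc(at + πn_i))²` (`Christoffel.profBox`: one `MC.expI` for `sin(at)`; per mode, off the lattice the CENTRED form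
  `(−1)^n c sin(at)·(1/y_c + a(t_c−t)/(y y_c))` — exact algebra, so coefficient cancellation costs no interval width —
  and near the lattice the Taylor floor `1 − y²/6 ≤ sinc y ≤ 1`),
(this file: the boxes and their inclusion theorems; the checker itself, which accepts iff `F.hi < P_T.lo` for every piece,
is `ChristoffelCertificateCheck.lean`).  Soundness (`Christoffel.certificate_sound`, part II): then
`Σ x_n x_k G_a(n,k) < m ≤ ‖û(½+it)‖²` on the block with `m = (F.hi + ½)/S`, so by `GramFormExclusion`:

* ★ `Christoffel.measure_Icc_eq_zero_of_natValued_of_checkCert` — every positive measure representing Weil's form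
  on `[-a, a]` that is ℕ-valued on bounded Borel sets VANISHES on `[p/q, p'/q]`;
* ★ `Christoffel.im_not_mem_Icc_of_riemannHypothesis_of_checkCert` — under RH no zero of `ζ` has its ordinate there.

The instances (one table-validity file and certificate files per rung) are separate data files.
No named facts, standard axioms; nothing here bears on the truth of RH.
-/

set_option autoImplicit false

noncomputable section

open Complex Set MeasureTheory
open scoped Real ENNReal

namespace Summit.Ventures.WeilGRH

open Literature.NumberTheory.LFunctions
open Literature.NumberTheory.LFunctions.Yoshida1992 (chi gramCoeff freq PrimeLen PrimeData)
open Literature.NumberTheory.LFunctions.Yoshida1992.Encl (Consts IdxRec ConstsValid OffValid DiagValid IdxValid TabValid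
  tget gramBox mem_gramBox sgn neg_one_zpow_eq_sgn mem_of_eq)
open Literature.Analysis.ValidatedNumerics.NumericsMP (MI MC)

variable {a : ℝ}

/-! ## A Taylor floor for `sinc` -/
/-- `1 − y²/6 ≤ sinc y` for every real `y` (`|y − sin y| ≤ |y|³/6`). -/
theorem one_sub_sq_div_six_le_sinc (y : ℝ) : 1 - y ^ 2 / 6 ≤ Real.sinc y := by
  rcases eq_or_ne y 0 with rfl | hy
  · simp [Real.sinc_zero]
  · rw [Real.sinc_of_ne_zero hy]
    have h := Real.abs_sub_sin_le y
    rcases lt_or_gt_of_ne hy with hneg | hpos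
    · rw [abs_of_neg hneg] at h
      have h1 : -((-y) ^ 3 / 6) ≤ y - Real.sin y := (abs_le.1 h).1
      rw [le_div_iff_of_neg hneg]
      nlinarith
    · rw [abs_of_pos hpos] at h
      have h1 : y - Real.sin y ≤ y ^ 3 / 6 := (abs_le.1 h).2
      rw [le_div_iff₀ hpos]
      nlinarith

namespace Christoffel

/-! ## Records and entry boxes at integer modes -/
/-- The special-value record at an integer mode: the table record for `m ≥ 0`, its flip for `m < 0`. -/
def rec (tab : List IdxRec) (m : ℤ) : IdxRec :=
  if 0 ≤ m then tget tab m.toNat else (tget tab (-m).toNat).flip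

/-- Entry box of `G_a(n,m)` at integer modes (reflection `G(n,m) = G(−n,−m)` puts the first index `≥ 0`). -/
def gbox (S : ℕ) (C : Consts) (tab : List IdxRec) (n m : ℤ) : MI :=
  if 0 ≤ n then gramBox S C (rec tab n) (rec tab m) n m else gramBox S C (rec tab (-n)) (rec tab (-m)) (-n) (-m)

variable {S : ℕ} {ks : List PrimeLen} {C : Consts} {tab : List IdxRec} {Nt : ℕ}

/-- The record at an integer mode is off-diagonally valid. -/
theorem offValid_rec (htab : TabValid S a ks Nt tab) {m : ℤ} (hm : m.natAbs < Nt) :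
    OffValid S a ks m (rec tab m) := by
  unfold rec
  split_ifs with h
  · have hv := (htab m.toNat (by omega)).1
    rwa [Int.toNat_of_nonneg h] at hv
  · have hv := (htab (-m).toNat (by omega)).1
    rw [Int.toNat_of_nonneg (by omega)] at hv
    have := hv.flip
    rwa [neg_neg] at this

/-- The record at a non-negative integer mode is diagonally valid. -/
theorem diagValid_rec (htab : TabValid S a ks Nt tab) {m : ℤ} (h0 : 0 ≤ m) (hm : m.natAbs < Nt) :
    DiagValid S a m (rec tab m) := by
  unfold rec
  rw [if_pos h0]
  have hv := (htab m.toNat (by omega)).2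
  rwa [Int.toNat_of_nonneg h0] at hv

/-- **`gbox ∋ G_a(n,m)`** for `|n|, |m| < Nt`. -/
theorem mem_gbox (hS : 0 < S) (ha0 : 0 < a) (hks : PrimeData a ks) (hC : ConstsValid S a ks C)
    (htab : TabValid S a ks Nt tab) {n m : ℤ} (hn : n.natAbs < Nt) (hm : m.natAbs < Nt) :
    MI.mem S (gramCoeff a n m) (gbox S C tab n m) := by
  unfold gbox
  split_ifs with h
  · exact mem_gramBox hS ha0 hks hC (offValid_rec htab hn) (fun _ ↦ diagValid_rec htab h hn) (offValid_rec htab hm)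
  · rw [← Literature.NumberTheory.LFunctions.Yoshida1992.Encl.gramCoeff_neg_neg a n m]
    exact mem_gramBox hS ha0 hks hC (offValid_rec htab (by omega)) (fun _ ↦ diagValid_rec htab (by omega) (by omega))
      (offValid_rec htab (by omega))

/-! ## The form box -/
/-- Coefficient `c_i` (zero beyond the list). -/
def coefAt (c : List ℤ) (i : ℕ) : ℤ := c.getD i 0

/-- The mode of index `i`: `n_i = i − N`. -/
def mode (N i : ℕ) : ℤ := (i : ℤ) - N

/-- Row box: `Σ_{j<k} G(n_i, n_j)·(c_i c_j)`. -/
def rowBox (S : ℕ) (C : Consts) (tab : List IdxRec) (N : ℕ) (c : List ℤ) (i : ℕ) : ℕ → MI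
  | 0 => MI.ofInt S 0
  | k + 1 => (rowBox S C tab N c i k).add ((gbox S C tab (mode N i) (mode N k)).mulInt (coefAt c i * coefAt c k))

/-- Form box: `Σ_{i<k} Σ_{j<2N+1} G(n_i, n_j)·(c_i c_j)`. -/
def formBox (S : ℕ) (C : Consts) (tab : List IdxRec) (N : ℕ) (c : List ℤ) : ℕ → MI
  | 0 => MI.ofInt S 0
  | k + 1 => (formBox S C tab N c k).add (rowBox S C tab N c k (2 * N + 1))

/-- The modes of radius `N` have index `< Nt` once `N < Nt`. -/
theorem natAbs_mode_lt {N i Nt : ℕ} (hi : i < 2 * N + 1) (hN : N < Nt) : (mode N i).natAbs < Nt := by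
  unfold mode; omega

/-- `rowBox ∋` the row sum. -/
theorem mem_rowBox (hS : 0 < S) (ha0 : 0 < a) (hks : PrimeData a ks) (hC : ConstsValid S a ks C)
    (htab : TabValid S a ks Nt tab) {N : ℕ} (hN : N < Nt) (c : List ℤ) {i : ℕ} (hi : i < 2 * N + 1) :
    ∀ k, k ≤ 2 * N + 1 →
      MI.mem S (∑ j ∈ Finset.range k, gramCoeff a (mode N i) (mode N j) * ((coefAt c i * coefAt c j : ℤ) : ℝ))
        (rowBox S C tab N c i k)
  | 0, _ => by simpa [rowBox] using MI.mem_ofInt S 0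
  | k + 1, hk => by
      rw [Finset.sum_range_succ, rowBox]
      exact MI.mem_add (mem_rowBox hS ha0 hks hC htab hN c hi k (by omega))
        (MI.mem_mulInt (mem_gbox hS ha0 hks hC htab (natAbs_mode_lt hi hN) (natAbs_mode_lt (by omega) hN)) _)

/-- `formBox ∋` the form. -/
theorem mem_formBox (hS : 0 < S) (ha0 : 0 < a) (hks : PrimeData a ks) (hC : ConstsValid S a ks C)
    (htab : TabValid S a ks Nt tab) {N : ℕ} (hN : N < Nt) (c : List ℤ) :
    ∀ k, k ≤ 2 * N + 1 →
      MI.mem S (∑ i ∈ Finset.range k, ∑ j ∈ Finset.range (2 * N + 1),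
        gramCoeff a (mode N i) (mode N j) * ((coefAt c i * coefAt c j : ℤ) : ℝ)) (formBox S C tab N c k)
  | 0, _ => by simpa [formBox] using MI.mem_ofInt S 0
  | k + 1, hk => by
      rw [Finset.sum_range_succ, formBox]
      exact MI.mem_add (mem_formBox hS ha0 hks hC htab hN c k (by omega))
        (mem_rowBox hS ha0 hks hC htab hN c (by omega) (2 * N + 1) le_rfl)

/-! ## The profile box on a piece (centred form) -/
/-- Inverse of an interval that avoids `0` (`none` if it straddles `0`). -/
def invBox (S : ℕ) (Y : MI) : Option MI :=
  if 0 < Y.lo then MI.divPos S (MI.ofInt S 1) Y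
  else if Y.hi < 0 then (MI.divPos S (MI.ofInt S 1) Y.neg).map MI.neg
  else none

/-- `invBox` encloses `1/y` (when it answers). -/
theorem mem_invBox (hS : 0 < S) {y : ℝ} {Y B : MI} (hy : MI.mem S y Y) (h : invBox S Y = some B) :
    y ≠ 0 ∧ MI.mem S (1 / y) B := by
  unfold invBox at h
  split_ifs at h with h1 h2
  · have hy0 : 0 < y := MI.pos_of_lo_pos hy h1
    exact ⟨hy0.ne', by simpa using MI.mem_divPos hS h (MI.mem_ofInt S 1) hy⟩
  · have hy0 : y < 0 := MI.neg_of_hi_neg hy h2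
    cases hB : MI.divPos S (MI.ofInt S 1) Y.neg with
    | none => rw [hB] at h; simp at h
    | some B' =>
        rw [hB] at h
        simp only [Option.map_some, Option.some.injEq] at h
        subst h
        have hm := MI.mem_divPos hS hB (MI.mem_ofInt S 1) (MI.mem_neg hy)
        refine ⟨hy0.ne, ?_⟩
        have := MI.mem_neg hm
        refine mem_of_eq this ?_
        push_cast
        field_simp

/-- The Taylor floor box `[1 − y²/6, 1] ∋ sinc y` for `y ∈ Y`. -/
def sincTaylorBox (S : ℕ) (Y : MI) : MI :=
  MI.span (MI.lower ((MI.ofInt S 1).sub ((MI.sqr S Y).divNat 6))) (MI.ofInt S 1)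

/-- `sincTaylorBox` encloses `sinc y`. -/
theorem mem_sincTaylorBox (hS : 0 < S) {y : ℝ} {Y : MI} (hY : MI.mem S y Y) :
    MI.mem S (Real.sinc y) (sincTaylorBox S Y) := by
  unfold sincTaylorBox
  set B' : MI := (MI.ofInt S 1).sub ((MI.sqr S Y).divNat 6) with hB'
  have hu : MI.mem S (1 - y ^ 2 / 6) B' := by
    have := MI.mem_sub (MI.mem_ofInt S 1) (MI.mem_divNat (MI.mem_sqr hS hY) (n := 6) (by norm_num))
    simpa using this
  refine MI.mem_span (MI.mem_lower hS B') (by simpa using MI.mem_ofInt S 1) ?_ (Real.sinc_le_one _)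
  exact (MI.lo_div_le hS hu).trans (one_sub_sq_div_six_le_sinc _)

/-- The running triple of the centred evaluation: point part `U ∋ Σ_reg (−1)^n c_i/y_i(t_c)`, cross part
`V ∋ Σ_reg (−1)^n c_i/(y_i(t) y_i(t_c))`, Taylor part `Z ∋ Σ_tay c_i sinc(y_i(t))`. -/
structure Acc where
  /-- point part -/
  U : MI
  /-- cross part -/
  V : MI
  /-- Taylor part -/
  Z : MI

/-- The argument boxes of mode `i` on the piece `T` and at its centre `Tc`: `y_i = a(t + ω_{n_i}) = at + πn_i`. -/
def argBox (S : ℕ) (C : Consts) (tab : List IdxRec) (N : ℕ) (T : MI) (i : ℕ) : MI :=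
  (T.add (rec tab (mode N i)).om).mul S C.A

/-- Is mode `i` treated by the quotient formula on the piece?  (`|y| > yT/S` on the piece and the centre on the same
side of `0`; otherwise the Taylor floor is used — near a lattice point the quotient is ill-conditioned.) -/
def regular (yT : ℕ) (Y Yc : MI) : Bool :=
  (decide ((yT : ℤ) < Y.lo) && decide (0 < Yc.lo)) || (decide (Y.hi < -(yT : ℤ)) && decide (Yc.hi < 0))

/-- One step of the centred evaluation. -/
def stepAcc (S yT : ℕ) (C : Consts) (tab : List IdxRec) (N : ℕ) (c : List ℤ) (T Tc : MI) (i : ℕ) (A : Acc) :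
    Option Acc :=
  let Y := argBox S C tab N T i
  let Yc := argBox S C tab N Tc i
  let w : ℤ := sgn (mode N i) 0 * coefAt c i
  if regular yT Y Yc then
    match invBox S Yc, invBox S (Y.mul S Yc) with
    | some IYc, some IYY => some ⟨A.U.add (IYc.mulInt w), A.V.add (IYY.mulInt w), A.Z⟩
    | _, _ => none
  else some ⟨A.U, A.V, A.Z.add ((sincTaylorBox S Y).mulInt (coefAt c i))⟩

/-- The centred evaluation over the modes `i < k`. -/
def accBox (S yT : ℕ) (C : Consts) (tab : List IdxRec) (N : ℕ) (c : List ℤ) (T Tc : MI) : ℕ → Option Acc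
  | 0 => some ⟨MI.ofInt S 0, MI.ofInt S 0, MI.ofInt S 0⟩
  | k + 1 =>
    match accBox S yT C tab N c T Tc k with
    | none => none
    | some A => stepAcc S yT C tab N c T Tc k A

/-- Profile box on a piece `T` with centre box `Tc`: an enclosure of `2a·W(t)²`, `W(t) = Σ_i c_i sinc(at + πn_i)`, valid
for every `t ∈ T`, computed in the centred form `W(t) = sin(at)·(U + a(t_c − t)·V) + Z`. -/
def profBox (S Kt kr yT : ℕ) (C : Consts) (tab : List IdxRec) (N : ℕ) (c : List ℤ) (T Tc : MI) : Option MI :=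
  match MC.expI S Kt kr C.P (T.mul S C.A), accBox S yT C tab N c T Tc (2 * N + 1) with
  | some E, some A =>
      let W := (E.im.mul S (A.U.add (((Tc.sub T).mul S C.A).mul S A.V))).add A.Z
      some (((MI.sqr S W).mul S C.A).mulInt 2)
  | _, _ => none

/-- The real quantities tracked by `Acc` (with the regular/Taylor split decided on the boxes). -/
def isReg (S yT : ℕ) (C : Consts) (tab : List IdxRec) (N : ℕ) (T Tc : MI) (i : ℕ) : Bool :=
  regular yT (argBox S C tab N T i) (argBox S C tab N Tc i)

/-- Soundness of `accBox`: the three partial sums lie in the three boxes. -/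
theorem mem_accBox (hS : 0 < S) (ha0 : 0 < a) (hC : ConstsValid S a ks C) (htab : TabValid S a ks Nt tab)
    {N : ℕ} (hN : N < Nt) (c : List ℤ) {yT : ℕ} {T Tc : MI} {t tc : ℝ} (ht : MI.mem S t T) (htc : MI.mem S tc Tc) :
    ∀ k, k ≤ 2 * N + 1 → ∀ {A : Acc}, accBox S yT C tab N c T Tc k = some A →
      MI.mem S (∑ i ∈ Finset.range k, if isReg S yT C tab N T Tc i then
          1 / (a * tc + π * (mode N i)) * ((sgn (mode N i) 0 * coefAt c i : ℤ) : ℝ) else 0) A.U ∧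
      MI.mem S (∑ i ∈ Finset.range k, if isReg S yT C tab N T Tc i then
          1 / ((a * t + π * (mode N i)) * (a * tc + π * (mode N i))) * ((sgn (mode N i) 0 * coefAt c i : ℤ) : ℝ)
          else 0) A.V ∧
      MI.mem S (∑ i ∈ Finset.range k, if isReg S yT C tab N T Tc i then 0 else
          Real.sinc (a * t + π * (mode N i)) * ((coefAt c i : ℤ) : ℝ)) A.Z ∧
      (∀ i < k, isReg S yT C tab N T Tc i = true → a * t + π * (mode N i) ≠ 0 ∧ a * tc + π * (mode N i) ≠ 0)
  | 0, _, A, h => by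
      simp only [accBox, Option.some.injEq] at h
      subst h
      refine ⟨?_, ?_, ?_, fun i hi ↦ absurd hi (by omega)⟩ <;> simpa using MI.mem_ofInt S 0
  | k + 1, hk, A, h => by
      unfold accBox at h
      split at h
      · simp at h
      · rename_i A₀ hA₀
        obtain ⟨hU, hV, hZ, hreg⟩ := mem_accBox hS ha0 hC htab hN c ht htc k (by omega) hA₀
        have hy : MI.mem S (a * t + π * (mode N k)) (argBox S C tab N T k) := by
          have hom := (offValid_rec htab (natAbs_mode_lt (by omega : k < 2 * N + 1) hN)).om
          refine mem_of_eq (MI.mem_mul hS (MI.mem_add ht hom) hC.ha) ?_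
          unfold freq; field_simp
        have hyc : MI.mem S (a * tc + π * (mode N k)) (argBox S C tab N Tc k) := by
          have hom := (offValid_rec htab (natAbs_mode_lt (by omega : k < 2 * N + 1) hN)).om
          refine mem_of_eq (MI.mem_mul hS (MI.mem_add htc hom) hC.ha) ?_
          unfold freq; field_simp
        unfold stepAcc at h
        simp only at h
        by_cases hr : regular yT (argBox S C tab N T k) (argBox S C tab N Tc k) = true
        · rw [if_pos hr] at h
          split at h
          · rename_i IYc IYY hIYc hIYY
            simp only [Option.some.injEq] at h
            subst h
            obtain ⟨hyc0, hinv1⟩ := mem_invBox hS hyc hIYc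
            obtain ⟨hyy0, hinv2⟩ := mem_invBox hS (MI.mem_mul hS hy hyc) hIYY
            have hy0 : a * t + π * (mode N k) ≠ 0 := fun e ↦ hyy0 (by rw [e, zero_mul])
            have hregk : isReg S yT C tab N T Tc k = true := hr
            refine ⟨?_, ?_, ?_, ?_⟩
            · rw [Finset.sum_range_succ, if_pos hregk]
              exact MI.mem_add hU (MI.mem_mulInt hinv1 _)
            · rw [Finset.sum_range_succ, if_pos hregk]
              exact MI.mem_add hV (MI.mem_mulInt hinv2 _)
            · rw [Finset.sum_range_succ, if_pos hregk, add_zero]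
              exact hZ
            · intro i hi hri
              rcases Nat.lt_succ_iff_lt_or_eq.1 hi with hi' | rfl
              · exact hreg i hi' hri
              · exact ⟨hy0, hyc0⟩
          · simp at h
        · rw [if_neg hr] at h
          simp only [Option.some.injEq] at h
          subst h
          have hregk : isReg S yT C tab N T Tc k = false := by
            unfold isReg; simpa using hr
          refine ⟨?_, ?_, ?_, ?_⟩
          · rw [Finset.sum_range_succ, hregk]; simpa using hU
          · rw [Finset.sum_range_succ, hregk]; simpa using hV
          · rw [Finset.sum_range_succ, hregk]
            simp only [Bool.false_eq_true, ↓reduceIte]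
            exact MI.mem_add hZ (MI.mem_mulInt (mem_sincTaylorBox hS hy) _)
          · intro i hi hri
            rcases Nat.lt_succ_iff_lt_or_eq.1 hi with hi' | rfl
            · exact hreg i hi' hri
            · rw [hregk] at hri; exact absurd hri (by simp)

/-- The centred identity for one regular mode: `c·sinc(y) = sin(at)·((−1)^n c/y_c + a(t_c − t)·(−1)^n c/(y y_c))`
(`y = at + πn`, `y_c = at_c + πn`, both `≠ 0`). -/
theorem sinc_centred {t tc : ℝ} {n : ℤ} (hy : a * t + π * n ≠ 0) (hyc : a * tc + π * n ≠ 0) (cf : ℤ) :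
    Real.sinc (a * t + π * n) * (cf : ℝ) =
      Real.sin (a * t) * (1 / (a * tc + π * n) * ((sgn n 0 * cf : ℤ) : ℝ) +
        a * (tc - t) * (1 / ((a * t + π * n) * (a * tc + π * n)) * ((sgn n 0 * cf : ℤ) : ℝ))) := by
  rw [Real.sinc_of_ne_zero hy]
  have hsg : Real.sin (a * t + π * n) = Real.sin (a * t) * (sgn n 0 : ℤ) := by
    rw [show a * t + π * n = a * t + n * π by ring, Real.sin_add_int_mul_pi, ← neg_one_zpow_eq_sgn, add_zero, mul_comm]
  rw [hsg]
  push_cast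
  field_simp
  ring

/-- **Soundness of `profBox`**: `P.lo/S ≤ 2a·(Σ_{i<2N+1} c_i sinc(at + πn_i))²` for every `t ∈ T` (`t_c ∈ Tc`). -/
theorem le_profile_of_profBox (hS : 0 < S) (ha0 : 0 < a) (hC : ConstsValid S a ks C) (htab : TabValid S a ks Nt tab)
    {N : ℕ} (hN : N < Nt) (c : List ℤ) {Kt kr yT : ℕ} {T Tc P : MI} {t tc : ℝ} (ht : MI.mem S t T)
    (htc : MI.mem S tc Tc) (h : profBox S Kt kr yT C tab N c T Tc = some P) :
    (P.lo : ℝ) / S ≤ 2 * a * (∑ j ∈ Finset.range (2 * N + 1),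
      ((coefAt c j : ℤ) : ℝ) * Real.sinc (a * t + π * (mode N j))) ^ 2 := by
  unfold profBox at h
  split at h
  · rename_i E A hE hA
    simp only [Option.some.injEq] at h
    subst h
    have hθ : MI.mem S (t * a) (T.mul S C.A) := MI.mem_mul hS ht hC.ha
    have hexp := MC.mem_expI hS hC.pi hE hθ
    have hsin : MI.mem S (Real.sin (a * t)) E.im := by
      have := hexp.2
      rwa [Complex.exp_ofReal_mul_I_im, mul_comm t a] at this
    obtain ⟨hU, hV, hZ, hreg⟩ := mem_accBox hS ha0 hC htab hN c ht htc (2 * N + 1) le_rfl hA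
    -- the centred identity, summed
    set Ru := ∑ i ∈ Finset.range (2 * N + 1), (if isReg S yT C tab N T Tc i then
        1 / (a * tc + π * (mode N i)) * ((sgn (mode N i) 0 * coefAt c i : ℤ) : ℝ) else 0) with hRu
    set Rv := ∑ i ∈ Finset.range (2 * N + 1), (if isReg S yT C tab N T Tc i then
        1 / ((a * t + π * (mode N i)) * (a * tc + π * (mode N i))) * ((sgn (mode N i) 0 * coefAt c i : ℤ) : ℝ)
        else 0) with hRv
    set Rz := ∑ i ∈ Finset.range (2 * N + 1), (if isReg S yT C tab N T Tc i then 0 else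
        Real.sinc (a * t + π * (mode N i)) * ((coefAt c i : ℤ) : ℝ)) with hRz
    have hW : ∑ j ∈ Finset.range (2 * N + 1), ((coefAt c j : ℤ) : ℝ) * Real.sinc (a * t + π * (mode N j)) =
        Real.sin (a * t) * (Ru + (tc - t) * a * Rv) + Rz := by
      have hterm : ∀ i ∈ Finset.range (2 * N + 1),
          ((coefAt c i : ℤ) : ℝ) * Real.sinc (a * t + π * (mode N i)) =
            Real.sin (a * t) * (if isReg S yT C tab N T Tc i then
                1 / (a * tc + π * (mode N i)) * ((sgn (mode N i) 0 * coefAt c i : ℤ) : ℝ) else 0) +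
              Real.sin (a * t) * ((tc - t) * a) * (if isReg S yT C tab N T Tc i then
                1 / ((a * t + π * (mode N i)) * (a * tc + π * (mode N i))) *
                  ((sgn (mode N i) 0 * coefAt c i : ℤ) : ℝ) else 0) +
              (if isReg S yT C tab N T Tc i then 0 else Real.sinc (a * t + π * (mode N i)) * ((coefAt c i : ℤ) : ℝ)) := by
        intro i hi
        by_cases hri : isReg S yT C tab N T Tc i = true
        · simp only [hri, ↓reduceIte, add_zero]
          obtain ⟨hy, hyc⟩ := hreg i (Finset.mem_range.1 hi) hri
          rw [mul_comm, sinc_centred hy hyc]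
          ring
        · simp only [hri, Bool.false_eq_true, ↓reduceIte, mul_zero, zero_add]
          ring
      rw [Finset.sum_congr rfl hterm, Finset.sum_add_distrib, Finset.sum_add_distrib, ← Finset.mul_sum,
        ← Finset.mul_sum, hRu, hRv, hRz]
      ring
    have hcross : MI.mem S ((tc - t) * a) ((Tc.sub T).mul S C.A) := MI.mem_mul hS (MI.mem_sub htc ht) hC.ha
    have hWm : MI.mem S (∑ j ∈ Finset.range (2 * N + 1), ((coefAt c j : ℤ) : ℝ) * Real.sinc (a * t + π * (mode N j)))
        ((E.im.mul S (A.U.add (((Tc.sub T).mul S C.A).mul S A.V))).add A.Z) := by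
      rw [hW]
      exact MI.mem_add (MI.mem_mul hS hsin (MI.mem_add hU (MI.mem_mul hS hcross hV))) hZ
    have hP := MI.mem_mulInt (MI.mem_mul hS (MI.mem_sqr hS hWm) hC.ha) 2
    have e : (∑ j ∈ Finset.range (2 * N + 1), ((coefAt c j : ℤ) : ℝ) * Real.sinc (a * t + π * (mode N j))) ^ 2 * a *
        ((2 : ℤ) : ℝ) = 2 * a * (∑ j ∈ Finset.range (2 * N + 1),
          ((coefAt c j : ℤ) : ℝ) * Real.sinc (a * t + π * (mode N j))) ^ 2 := by
      push_cast; ring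
    rw [← e]
    exact MI.lo_div_le hS hP
  · simp at h

end Christoffel

end Summit.Ventures.WeilGRH

end
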